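import Summits.QuantumFields.QCD.Theses.PauliWegnerSea
import Summits.QuantumFields.QCD.Theses.WilsonMobilityGap

/-!
# Line `feshbach-fibre-tameness` — checked skeleton for crux stmt-QuantumFields-9151
(`Summit.QuantumFields.QCD.Theses.PauliWegnerSea.PhaseQuenchedFlavourDecay`, rank-6 crux D of route PauliWegnerSea,
byte-identical to `WilsonMobilityGap.PhaseQuenchedFlavourDecay`; shared item, staffed once)

Crux: `∀ N_f reg m > 0, UPPER(reg, m) → CONC(reg, m)` — the phase-quenched `s < 1` fractional-moment decay of the quark
propagator (clause (ii) of `MobilityGap`) implies exponential Euclidean-time decay, at ONE rate `δ'` chosen BEFORE the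
observables, of every phase-quenched correlator `E_ν⟨A(0)B(ne₀)⟩_F` with `A` flavour-charged (`crux_iff`, `Iff.rfl`).
Disprover's reduction (evidence notes v2/v5, `whyItResists §4`, `firstMomentDecay_of_upper_of_localTailEntry`):
crux ⟸ UPPER ∧ [a-priori, `n`-free, volume- and `k`-uniform LOCAL TAIL of Wick minors] ∧ Wick/charge bookkeeping; the open core is
a local Wegner-type anti-concentration under `ν = |det D|·μ_W`.  Triage r1 (all three): the tail exponent must be uniform in the
minor size `r` (Q), minors must be indexed by `QuarkVar` of the full flavour-block-diagonal matrix (M), every `∀ reg` a-priori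
statement is guarded by UPPER (§B), and the transfer must be the CROSSING SPLIT of card `crossing-split-integrability` (r-free rate).

Line (idea card `feshbach-fibre-tameness`, ideator 1; triage r1-1/2/3: pass with sharpenings).  LEVER: Schur–Feshbach isolation
onto the finite block `T` = sites of the Wick indices.  Conditionally on the far field `U`, the sea weight and every `T`-supported
minor live on the FIBRE `SU(3)^{star links of T}`: `|det D(refit_U W)| = |det D_out(U)|·|det S_T(W; Γ_U)|` and
`|det D|·|minor of D⁻¹| = |det D_out(U)|·|cominor of S_T|` (`FeshbachIsolation`, documentation Prop below; Mathlib
`Matrix.det_fromBlocks₁₁` / tree `det_eq_det_toBlock_mul_det_schur`), the holed determinant CANCELLING between weight and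
normalisation and the far field entering only through ONE boundary matrix `Γ_U = D_out(U)⁻¹|∂T`.  Hence the a-priori tail
`E_ν[g·1{g > K}] ≤ C K^{-γ}` (`LocalTail`) is, fibre by fibre, a RELATIVE small-ball inequality between two members `𝒫 = |det D|`,
`𝒬 = |det D|·g` of ONE finite-dimensional space of link polynomials, whose exponent and constant are uniform over the unit
sphere of that space (tameness = uniform Łojasiewicz/Remez: `stub_tameFibre`), up to an explicit DISTORTION factor
`(sup_fibre 𝒬 / sup_fibre 𝒫)^{1+γ}` — the quantitative "no common zeros" quantity of the card, whose `ν`-moments are the line's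
first bet (`stub_distortionMoment`, NCZ-in-mean; triage r1-1/r1-2: the sup form is expected to fail in high codimension, only
the averaged form is asked).  `stub_fibreReduction` is the isolation itself: refit-disintegration of `μ_W` along the fibre, the
bounded-coupling comparison `e^{-βS} ≍ 1` on the `≤ 96 r` plaquettes touching the fibre, the tame inequality, Hölder against the
distortion moments, and the absorption `E_ν g ≤ 2K₀ + 1` — giving `LocalTail` along every `k` with `|β_k| ≤ β₀`.
`stub_exponentFloor` is the r-LEVEL input every line needs (triage §A), in this line's dress: the relative small-ball exponent
of `(det S_T, cominors)` does not degrade with `|T|` (each near-zero mode of the Feshbach matrix is paid once by the sea: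
fibre Minami regularity).  `stub_weakCouplingTail` is the DECLARED GAP of the line: along `k` with `|β_k| ≥ β₀` (weak coupling `β_k → +∞` on every
asymptotically free trajectory, plus the unphysical but admissible corner `β_k → −∞`) the fibre law is frozen at scale `|β_k|^{-1/2}` and the card's "tilt stability in ν-average" needs distortion moments equivalent to the target
(this planner's analysis, line card §Why the regime split) — there the tail must come from weak-coupling technology
(admissibility gap of the local Wilson–Dirac operator on smooth fields, dislocation rarity, sea factor; or the companion LDOS
cards under UPPER), not from fibre resampling.  `stub_crossingSplit` is the transfer (card `crossing-split-integrability`: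
`SplitBound` + Laplace expansion by crossing matchings + translation invariance + layer cake), with the a-priori input in the
first-moment-tail form this line produces.

`composition_closed` (the six stub STATEMENTS ⇒ `∀ N_f reg m>0, Upper → Conc`, merging the two coupling regimes by
`le_total` with exponent `min γ₁ γ₂`) and `localTail_of_regimes` are sorry-free; `PhaseQuenchedFlavourDecay_of` concludes the
crux `PauliWegnerSea.PhaseQuenchedFlavourDecay` BY NAME from exactly `stub_crossingSplit`, `stub_fibreReduction`, `stub_tameFibre`,
`stub_exponentFloor`, `stub_distortionMoment`, `stub_weakCouplingTail`, and `PhaseQuenchedFlavourDecay_proof` concludes the shared,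
byte-identical copy `WilsonMobilityGap.PhaseQuenchedFlavourDecay` BY NAME (`crux_iff_wilsonMobilityGap`, `Iff.rfl`).

Disproof used (Disproof.lean v5 of refuter-cdisprove-stmt-QuantumFields-9151-0 is not mounted on this hub — `run/gate/evidence`
absent, `ledger crux cat … Disproof.lean` has no workfile — read through its five evidence notes): `phaseQuenchedFlavourDecay_iff`
mirrored as `crux_iff` (`Iff.rfl`); `PhaseQuenchedFlavourDecay_false_without_charge` / `_false_without_qNeZero` honoured —
charge and `q ≠ 0` are used in exactly one place, the Laplace-by-crossing-matchings step inside `stub_crossingSplit`; the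
near-miss `_false_without_upper` — UPPER enters `stub_crossingSplit` (Markov on the crossing entries) and guards
`stub_distortionMoment` / `stub_weakCouplingTail` (§B: unguarded `∀ reg` a-priori statements are false on Aoki-phase data);
`phaseQuenchedFlavourDecay_iff_bare` — `(∀ f, 0 < m f)` is a pass-through binder only; `upper_of_heavy` /
`crux_hypotheses_inhabited` — in the heavy regime `g` is bounded configuration-wise (`norm_inv_wilsonDirac_apply_le`) and every
stub is trivially true, a consistency check; §4 / (f) — `LocalTail` is the minor version of `LocalTailEntry` in first-moment-tail
form (`P(g > K) ≤ K⁻¹ E[g 1{g>K}]` converts).  No `Negative/` lemma has landed for this crux; the neighbouring crux's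
`TiltedFlatness/Negative/MasslessKernel` (`det ≡ 0` fibres exist at `m = 0`) is respected by the guard `0 < s ≤ 𝒫(W₀)` of
`TameFibre`, and `Negative/TwoWellFloor` (β-uniform PER-OUTSIDE small balls are refutable) by asking fibre statements only
untilted (`TameFibre`, Haar) or `ν`-averaged at bounded coupling (`DistortionMomentOn`), never per outside uniformly in `β`.
-/

namespace Summit.QuantumFields.QCD.Cruxes.PhaseQuenchedFlavourDecay.FeshbachFibreTameness

open scoped BigOperators Topology Classical MeasureTheory Matrix ComplexConjugate
open Filter Set Function MeasureTheory
open Literature.MathematicalPhysics.QuantumFieldTheory Literature.MathematicalPhysics.QuantumLattice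
  Literature.Probability.LatticeModels

noncomputable section

/-- `SU(3)` (the tree's `SU3` abbreviation lives in `QCD.lean`, outside this file's import cone). -/
local notation "SU3" => Matrix.specialUnitaryGroup (Fin 3) ℂ

/-! ### §0 Packaging — verbatim copies of the crux's two clauses (`crux_iff` is `Iff.rfl`) -/

/-- UPPER: clause (ii) of `MobilityGap` for `(reg, m)` — phase-quenched fractional-moment decay of the colour–spin entry sum
of the flavour-`f` quark propagator, VERBATIM the hypothesis of the crux. -/
def Upper {Nf : ℕ} (reg : QCDRegularisation Nf) (m : Fin Nf → ℝ) : Prop :=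
  ∃ s δ C : ℝ, 0 < s ∧ s < 1 ∧ 0 < δ ∧ ∀ᶠ k in atTop, ∀ S : ℕ, reg.L k ≤ S → ∀ (f : Fin Nf) (v : Literature.Probability.LatticeModels.Site 4), v ∈ box 4 S → (∫ U : GaugeConfig 4 (2 * S + 1) (Matrix.specialUnitaryGroup (Fin 3) ℂ), ‖(diracMatrix U fun fl => reg.mcrit k + reg.a k * m fl / reg.Zm k).det‖ * (∑ a : Fin 3, ∑ i : Fin 4, ∑ b : Fin 3, ∑ j : Fin 4, ‖(diracMatrix U fun fl => reg.mcrit k + reg.a k * m fl / reg.Zm k)⁻¹ (quarkEquiv (f, (Torus.proj (2 * S + 1) 0, a, i))) (quarkEquiv (f, (Torus.proj (2 * S + 1) (v), b, j)))‖) ^ s ∂(wilsonMeasure (fundamentalRep (Fin 3)) (reg.β k))) / (∫ U : GaugeConfig 4 (2 * S + 1) (Matrix.specialUnitaryGroup (Fin 3) ℂ), ‖(diracMatrix U fun fl => reg.mcrit k + reg.a k * m fl / reg.Zm k).det‖ ∂(wilsonMeasure (fundamentalRep (Fin 3)) (reg.β k))) ≤ C * Real.exp (-(δ * (reg.a k *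 ‖v‖)))

/-- CONC: the conclusion of the crux for `(reg, m)` — one rate `δ' > 0` BEFORE the observables; for every pair of boxed
observables with `A` flavour-charged (`q ≠ 0`), a constant `C'` and the bound `‖E_ν⟨A(0)B(ne₀)⟩_F‖ ≤ C' e^{-δ' a_k n}` for all
large `k`, all `S ≥ L_k`, `n ≤ S`, VERBATIM. -/
def Conc {Nf : ℕ} (reg : QCDRegularisation Nf) (m : Fin Nf → ℝ) : Prop :=
  ∃ δ' : ℝ, 0 < δ' ∧ ∀ (R R' : ℕ) (A : QCDLatticeObservable Nf R) (B : QCDLatticeObservable Nf R'), (∃ (f₀ : Fin Nf) (q : ℤ), q ≠ 0 ∧ ∀ (θ : ℝ) (U : LGConfig 4 (Matrix.specialUnitaryGroup (Fin 3) ℂ)), ExteriorAlgebra.map (LinearMap.pi fun w => (Sum.elim (fun i => if (boxQuarkEquiv.symm i).1 = f₀ then Complex.exp (-((θ : ℂ) * Complex.I)) else 1) (fun i => if (boxQuarkEquiv.symm i).1 = f₀ then Complex.exp ((θ : ℂ) * Complex.I) else 1) (ofLex w)) • LinearMap.proj w) (A.F U) = Complex.exp (((q : ℝ) * θ : ℝ)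 * Complex.I) • A.F U) → ∃ C' : ℝ, ∀ᶠ k in atTop, ∀ S : ℕ, reg.L k ≤ S → ∀ n : ℕ, n ≤ S → ‖(∫ U : GaugeConfig 4 (2 * S + 1) (Matrix.specialUnitaryGroup (Fin 3) ℂ), (‖(diracMatrix U fun fl => reg.mcrit k + reg.a k * m fl / reg.Zm k).det‖ : ℂ) * (fermiIntegral (A.onTorus (2 * S + 1) 0 U * B.onTorus (2 * S + 1) (Pi.single 0 (n : ℤ)) U * fermiBoltzmann U fun fl => reg.mcrit k + reg.a k * m fl / reg.Zm k) / fermiIntegral (fermiBoltzmann U fun fl => reg.mcrit k + reg.a k * m fl / reg.Zm k)) ∂(wilsonMeasure (fundamentalRep (Fin 3)) (reg.β k))) / (∫ U : GaugeConfig 4 (2 * S + 1) (Matrix.specialUnitaryGroup (Fin 3) ℂ), (‖(diracMatrix U fun fl => reg.mcrit k + reg.a k * m fl / reg.Zm k).det‖ : ℂ) ∂(wilsonMeasure (fundamentalRep (Fin 3)) (reg.β k)))‖ ≤ C' * Real.exp (-(δ' * (reg.a k * n)))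

/-- The crux re-read through the packaging (definitional): `∀ N_f reg m > 0, Upper → Conc`
(= the disprover's `phaseQuenchedFlavourDecay_iff`). -/
theorem crux_iff :
    Summit.QuantumFields.QCD.Theses.PauliWegnerSea.PhaseQuenchedFlavourDecay ↔
      ∀ (Nf : ℕ) (reg : QCDRegularisation Nf) (m : Fin Nf → ℝ), (∀ f, 0 < m f) → Upper reg m → Conc reg m :=
  Iff.rfl

/-! ### §1 The a-priori target: volume-, position- and `k`-uniform local tails of Wick minors -/

/-- The bare mass tuple of the trajectory at step `k`: `m_f(k) = m_crit(k) + a_k m_f / Z_m(k)` (verbatim the crux's lambda). -/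
def bare {Nf : ℕ} (reg : QCDRegularisation Nf) (m : Fin Nf → ℝ) (k : ℕ) : Fin Nf → ℝ :=
  fun fl => reg.mcrit k + reg.a k * m fl / reg.Zm k

/-- The phase-quenched (`|det diracMatrix|`-reweighted) Wilson expectation on the torus of side `2S+1` — the normalised
ratio of Bochner integrals appearing in UPPER and in the crux. -/
def pqExpect {Nf : ℕ} (β : ℝ) (S : ℕ) (mq : Fin Nf → ℝ) (F : GaugeConfig 4 (2 * S + 1) SU3 → ℝ) : ℝ :=
  (∫ U : GaugeConfig 4 (2 * S + 1) SU3, ‖(diracMatrix U mq).det‖ * F U ∂(wilsonMeasure (fundamentalRep (Fin 3)) β)) /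
    (∫ U : GaugeConfig 4 (2 * S + 1) SU3, ‖(diracMatrix U mq).det‖ ∂(wilsonMeasure (fundamentalRep (Fin 3)) β))

/-- `𝒫(U) = |det D(U)|`, the sea weight (full `N_f`-flavour Wilson–Dirac matrix). -/
def detNorm {Nf L : ℕ} [NeZero L] (U : GaugeConfig 4 L SU3) (mq : Fin Nf → ℝ) : ℝ :=
  ‖(diracMatrix U mq).det‖

/-- `g(U) = |det (D(U)⁻¹)[I, J]|`, the norm of the `r × r` Wick minor of the inverse `N_f`-flavour Wilson–Dirac matrix with
rows `I` and columns `J` — ARBITRARY quark variables (flavour included: `diracMatrix` is flavour-block-diagonal, so one such minor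
is a product over flavours of single-flavour minors, triage (M)); Mathlib's total inverse (junk `0` on `{det D = 0}`, exactly as
in the crux). -/
def minorNorm {Nf L r : ℕ} [NeZero L] (U : GaugeConfig 4 L SU3) (mq : Fin Nf → ℝ) (I J : Fin r → QuarkVar Nf L) : ℝ :=
  ‖((diracMatrix U mq)⁻¹.submatrix (fun t => quarkEquiv (I t)) (fun t => quarkEquiv (J t))).det‖

/-- `𝒬(U) = |det D(U)| · g(U)` — by Jacobi's complementary-minor identity the norm of the COMPLEMENTARY minor of `D(U)` (rows
`Iᶜ`, columns `Jᶜ`), a polynomial in the links, whenever `det D(U) ≠ 0`; `0` on `{det D = 0}`. -/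
def cominorNorm {Nf L r : ℕ} [NeZero L] (U : GaugeConfig 4 L SU3) (mq : Fin Nf → ℝ)
    (I J : Fin r → QuarkVar Nf L) : ℝ :=
  detNorm U mq * minorNorm U mq I J

/-- LOCAL TAIL on a set of steps `k` (predicate `P`): for every minor size `r` ONE constant `C_r` such that, eventually in `k`
with `P k`, for all volumes `S ≥ L_k`, ALL placements `I, J` of the `2r` quark variables on the torus and all `K ≥ 1`,
`E_ν[g · 1{g > K}] ≤ C_r K^{-γ}` — the first-moment tail of the Wick minor under the phase-quenched measure, with the EXPONENT
`γ` FIXED OUTSIDE (uniform in `r`, the positions, the volume and `k`: quantifier order (Q) of triage r1-2/r1-3). -/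
def LocalTailOn {Nf : ℕ} (reg : QCDRegularisation Nf) (m : Fin Nf → ℝ) (γ : ℝ) (P : ℕ → Prop) : Prop :=
  ∀ r : ℕ, ∃ C : ℝ, 0 < C ∧ ∀ᶠ k in atTop, P k → ∀ S : ℕ, reg.L k ≤ S →
    ∀ (I J : Fin r → QuarkVar Nf (2 * S + 1)) (K : ℝ), 1 ≤ K →
      pqExpect (reg.β k) S (bare reg m k)
          (fun U => if K < minorNorm U (bare reg m k) I J then minorNorm U (bare reg m k) I J else 0) ≤
        C * K ^ (-γ)

/-- LOCAL TAIL along the whole trajectory (no regime predicate): the a-priori input of the transfer `stub_crossingSplit`. -/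
def LocalTail {Nf : ℕ} (reg : QCDRegularisation Nf) (m : Fin Nf → ℝ) (γ : ℝ) : Prop :=
  ∀ r : ℕ, ∃ C : ℝ, 0 < C ∧ ∀ᶠ k in atTop, ∀ S : ℕ, reg.L k ≤ S →
    ∀ (I J : Fin r → QuarkVar Nf (2 * S + 1)) (K : ℝ), 1 ≤ K →
      pqExpect (reg.β k) S (bare reg m k)
          (fun U => if K < minorNorm U (bare reg m k) I J then minorNorm U (bare reg m k) I J else 0) ≤
        C * K ^ (-γ)

/-! ### §2 Fibre vocabulary (the route's `star`/`refit` idiom for a general finite site set `T`) -/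

variable {L : ℕ}

/-- The FIBRE of a finite site set `T`: the links with an endpoint in `T` (the union of the stars of the sites of `T`). -/
def fibre (T : Finset (TorusSite 4 L)) (e : Edge 4 L) : Prop :=
  e.1 ∈ T ∨ Site.shift e.1 e.2 ∈ T

/-- `refit T U W`: the configuration with the fibre links of `T` taken from `W` and all other links from the OUTSIDE `U`. -/
def refit (T : Finset (TorusSite 4 L)) (U W : GaugeConfig 4 L SU3) : GaugeConfig 4 L SU3 :=
  fun e => if fibre T e then W e else U e

/-- The block `T(I, J)` of a Wick minor: the sites carrying its row and column quark variables (`|T| ≤ 2r`). -/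
def sitesOf {Nf r : ℕ} [NeZero L] (I J : Fin r → QuarkVar Nf L) : Finset (TorusSite 4 L) :=
  (Finset.univ.image fun t => (I t).2.1) ∪ Finset.univ.image fun t => (J t).2.1

/-- Product Haar probability on all links of the torus of side `L` (integrands below depend on fibre links only). -/
def piHaar (L : ℕ) [NeZero L] : Measure (GaugeConfig 4 L SU3) :=
  Measure.pi fun _ : Edge 4 L => haarProbability SU3

/-- The DISTORTION of the outside `U` on the fibre of `T(I,J)`: `max(1, sup_W 𝒬(refit U W) / sup_W 𝒫(refit U W))` — the
quantitative no-common-zeros quantity of the card (`= 1` by junk arithmetic on the `μ_W`-null set of outsides whose whole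
fibre has `det ≡ 0`; large exactly when the far field almost annihilates the sea weight on the entire fibre while a cominor
survives).  By `FeshbachIsolation` it is a function of the boundary matrix `Γ_U = D_out(U)⁻¹|∂T` (and the masses) alone. -/
def fibreDist {Nf r : ℕ} [NeZero L] (U : GaugeConfig 4 L SU3) (mq : Fin Nf → ℝ) (I J : Fin r → QuarkVar Nf L) : ℝ :=
  max 1 ((⨆ W, cominorNorm (refit (sitesOf I J) U W) mq I J) / ⨆ W, detNorm (refit (sitesOf I J) U W) mq)

/-! ### §3 The Feshbach objects (documentation Props — the lever; provable now, to be landed with `--supports`) -/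

/-- Quark indices located at a site of `T`. -/
def inBlock {Nf : ℕ} [NeZero L] (T : Finset (TorusSite 4 L)) (p : FermiIdx Nf L) : Prop :=
  (quarkEquiv.symm p).2.1 ∈ T

/-- The FESHBACH (Schur-complement) MATRIX of the `N_f`-flavour Wilson–Dirac matrix onto the quark indices over `T`:
`S_T = D_TT − D_{T,out} (D_out)⁻¹ D_{out,T}` (size `12 N_f |T|`; Mathlib's total inverse for `D_out`). -/
def feshbachMatrix {Nf : ℕ} [NeZero L] (T : Finset (TorusSite 4 L)) (U : GaugeConfig 4 L SU3) (mq : Fin Nf → ℝ) :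
    Matrix {p : FermiIdx Nf L // inBlock T p} {p : FermiIdx Nf L // inBlock T p} ℂ :=
  (diracMatrix U mq).toBlock (inBlock T) (inBlock T) -
    (diracMatrix U mq).toBlock (inBlock T) (fun p => ¬ inBlock T p) *
        ((diracMatrix U mq).toBlock (fun p => ¬ inBlock T p) (fun p => ¬ inBlock T p))⁻¹ *
      (diracMatrix U mq).toBlock (fun p => ¬ inBlock T p) (inBlock T)

/-- FESHBACH ISOLATION (deterministic, provable now from tree `det_eq_det_toBlock_mul_det_schur` / Mathlib
`Matrix.det_fromBlocks₁₁` and the nearest-neighbour structure of `wilsonDirac`): (1) the holed block `D_out` of `D(refit_U W)`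
does not see the fibre — it equals `D_out(U)`; (2) `det D(refit_U W) = det D_out(U) · det S_T(refit_U W)` whenever
`det D_out(U) ≠ 0`.  Consequently `𝒫 = |det D_out(U)|·|det S_T|` and (Schur on the complementary minor, whose deleted rows and
columns lie in the `T`-block) `𝒬 = |det D_out(U)|·|cominor of S_T|`: on each fibre the pair `(𝒫, 𝒬)` is `|det D_out(U)|` times
a pair of polynomials in the `≤ 8|T|` fibre links whose coefficients depend on the far field only through
`Γ_U = (D_out(U))⁻¹` restricted to the boundary indices.  Not a registered stub (S-sized); the proofs of `stub_tameFibre` /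
`stub_distortionMoment` rest on it. -/
def FeshbachIsolation : Prop :=
  ∀ (Nf L : ℕ) [NeZero L] (T : Finset (TorusSite 4 L)) (U W : GaugeConfig 4 L SU3) (mq : Fin Nf → ℝ),
    (diracMatrix (refit T U W) mq).toBlock (fun p => ¬ inBlock T p) (fun p => ¬ inBlock T p) =
        (diracMatrix U mq).toBlock (fun p => ¬ inBlock T p) (fun p => ¬ inBlock T p) ∧
      (((diracMatrix U mq).toBlock (fun p => ¬ inBlock T p) (fun p => ¬ inBlock T p)).det ≠ 0 →
        (diracMatrix (refit T U W) mq).det =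
          ((diracMatrix U mq).toBlock (fun p => ¬ inBlock T p) (fun p => ¬ inBlock T p)).det *
            (feshbachMatrix T (refit T U W) mq).det)

/-! ### §4 Intermediate statements of the line -/

/-- TAME FIBRE at exponent `γ`, minor size `r`, constant `C`: for every torus, every mass tuple, every outside `U`, every
placement `I, J` (block `T = sitesOf I J`, fibre = its star links), every scale `s > 0` REACHED by `𝒫` on the fibre and every
distortion bound `A ≥ 1` with `𝒬 ≤ A s` on the fibre, the UNTILTED (product Haar) relative small-ball inequality
`∫ 𝒬·1{K𝒫 < 𝒬} dHaar ≤ C K^{-γ} A^{1+γ} ∫ (𝒫 + 𝒬) dHaar` holds for all `K ≥ 1` — uniformly in `L`, the masses, the outside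
and the positions.  (The `𝒫 ≡ 0` fibres of `Negative/MasslessKernel` are excluded by `0 < s`.) -/
def TameFibre (Nf : ℕ) (γ : ℝ) (r : ℕ) (C : ℝ) : Prop :=
  ∀ (L : ℕ) [NeZero L] (mq : Fin Nf → ℝ) (U : GaugeConfig 4 L SU3) (I J : Fin r → QuarkVar Nf L) (s A K : ℝ),
    0 < s → 1 ≤ A → 1 ≤ K →
    (∃ W : GaugeConfig 4 L SU3, s ≤ detNorm (refit (sitesOf I J) U W) mq) →
    (∀ W : GaugeConfig 4 L SU3, cominorNorm (refit (sitesOf I J) U W) mq I J ≤ A * s) →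
      ∫ W, (if K * detNorm (refit (sitesOf I J) U W) mq < cominorNorm (refit (sitesOf I J) U W) mq I J then
              cominorNorm (refit (sitesOf I J) U W) mq I J else 0) ∂(piHaar L) ≤
        C * K ^ (-γ) * A ^ (1 + γ) *
          ∫ W, (detNorm (refit (sitesOf I J) U W) mq + cominorNorm (refit (sitesOf I J) U W) mq I J) ∂(piHaar L)

/-- DISTORTION MOMENT of order `p` on the steps `k` with `P k`: for every `r` ONE constant `M_r` with, eventually in `k` with
`P k`, for all `S ≥ L_k` and all placements, `∫ (𝒫 + 𝒬)·fibreDist^p dμ_W ≤ M_r ∫ (𝒫 + 𝒬) dμ_W` under the Wilson measure at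
`β_k` — i.e. the `(1+g)`-weighted `ν`-moment of order `p` of the distortion is bounded uniformly in the volume, the positions
and `k` (NCZ-in-mean). -/
def DistortionMomentOn {Nf : ℕ} (reg : QCDRegularisation Nf) (m : Fin Nf → ℝ) (p : ℝ) (P : ℕ → Prop) : Prop :=
  ∀ r : ℕ, ∃ M : ℝ, 0 < M ∧ ∀ᶠ k in atTop, P k → ∀ S : ℕ, reg.L k ≤ S →
    ∀ (I J : Fin r → QuarkVar Nf (2 * S + 1)),
      ∫ U : GaugeConfig 4 (2 * S + 1) SU3,
          (detNorm U (bare reg m k) + cominorNorm U (bare reg m k) I J) * fibreDist U (bare reg m k) I J ^ p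
          ∂(wilsonMeasure (fundamentalRep (Fin 3)) (reg.β k)) ≤
        M * ∫ U : GaugeConfig 4 (2 * S + 1) SU3,
          (detNorm U (bare reg m k) + cominorNorm U (bare reg m k) I J) ∂(wilsonMeasure (fundamentalRep (Fin 3)) (reg.β k))

/-! ### §5 Registered stubs -/

/-- **TRANSFER — the crossing split** (card `crossing-split-integrability`, consumed; the disprover's §4 / (f) with the
r-free-rate mechanism of triage (Q)): UPPER and the local tail of ALL Wick minors at SOME exponent `γ > 0` imply CONC.
Sketch: Wick's theorem in determinant form for boxed observables (`berezin_grassmannExp_quadratic_mul_noncommProd`,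
`fermiIntegral_fermiBoltzmann`, `QCDLatticeObservable.bounded`), every Wick term a minor `g` of the full `diracMatrix⁻¹`;
flavour charge `q ≠ 0` ⇒ Laplace expansion by crossing partial matchings: off `Ω_n = {a crossing f₀-entry > η_n}` one has
`X ≤ η_n^{|q|} Y` with `Y` a sum of products of an `A`-block and a `B`-block minor; `ν(Ω_n)` by Markov + UPPER + torus translation
invariance; `SplitBound` (Hölder `(1+ε,(1+ε)/ε)` on `Ω_n`, min-interpolation off it) with `ε < γ`, the `(1+ε)`-moments and
`E√Y` coming from `LocalTail` by layer cake (`P(g > K) ≤ K⁻¹·C K^{-γ}`) and absorption (`E_ν g ≤ 2K₀+1`); output rate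
`δ·min(ε(1−s/2)/(1+ε), |q|ε/(2+4ε))`, free of `r, R, R'`.  Why it might fail: only through bookkeeping (integrability and
measurability of Berezin coefficients in `U`; the total-inverse junk on `{det = 0}` is killed by the weight).  Size L.
Leans on: `Ideator2.SplitBound` (provable now), tree `GrassmannGaussianChargeRule.berezin_grassmannExp_quadratic_mul_word_eq_zero`,
`qcdPhaseQuenchedExpect_eq_div_complex`, `Literature.Probability.Moments.FractionalMomentTail`, `QCDPhaseQuenchedMomentUpgrade`. -/
theorem stub_crossingSplit :
    ∀ (Nf : ℕ) (reg : QCDRegularisation Nf) (m : Fin Nf → ℝ), (∀ f, 0 < m f) → Upper reg m →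
      ∀ γ : ℝ, 0 < γ → LocalTail reg m γ → Conc reg m := by
  sorry

/-- **FIBRE REDUCTION AT BOUNDED COUPLING — Feshbach isolation in action** (the card's steps (1), (2), (4)): tame fibres at an
r-uniform exponent `γ₀` and distortion moments of order `1 + p` along the steps with `|β_k| ≤ β₀` give the local tail there, at
exponent `min(γ₀, p)`.  Sketch: (i) refit-disintegration — `∫ F dHaar^{⊗E}(V) = ∫∫ F(refit_U W) dHaar^{⊗E}(W) dHaar^{⊗E}(U)`
(product structure + Fubini), applied to numerator and denominator of `pqExpect` written against `e^{-β_k S}·Haar^{⊗E}`;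
(ii) Jacobi: `𝒫·g·1{g > K} = 𝒬·1{K𝒫 < 𝒬}` pointwise (junk-consistent); (iii) bounded-coupling comparison: only the `≤ 96 r`
plaquettes touching the fibre see `W`, so for `|β_k| ≤ β₀` (either sign) `e^{-β_k S(refit_U W)} ≍ e^{-β_k S_far(U)}` within
`e^{±576 r β₀}` and the fibre integrals are Haar integrals up to that factor; (iv) `TameFibre` with `s = sup_fibre 𝒫` (attained), `A = fibreDist U`
(`𝒬 ≤ A s`), exponent lowered from `γ₀` to `γ = min(γ₀, p)` (monotone: `LHS ≤ RHS-integral` trivially for `K < A`);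
(v) integrate over outsides: `fibreDist ∘ refit_U = fibreDist U`, so (i) backwards gives
`E_{μ_W}[𝒬 1{K𝒫<𝒬}] ≤ C K^{-γ} E_{μ_W}[(𝒫+𝒬) fibreDist^{1+γ}] ≤ C M K^{-γ} E_{μ_W}[𝒫 + 𝒬]` by `DistortionMomentOn`
(`fibreDist ≥ 1`, `1+γ ≤ 1+p`); (vi) divide by `Z_ν = E_{μ_W} 𝒫 > 0` (`integral_norm_det_diracMatrix_pos_of_exists` in the
live case; `Z_ν = 0` makes `pqExpect` vanish): `T(K) ≤ C M K^{-γ}(1 + E_ν g)`, and absorption at `K₀ = (2CM)^{1/γ}` gives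
`E_ν g ≤ 2K₀ + 1`.  Why it might fail: it does not (measure theory on a finite product of compact groups); the risk is size —
measurability/continuity of `fibreDist` (sup over a compact fibre of a jointly continuous function) and the refit Fubini on
`GaugeConfig = Edge → SU(3)`.  Size M/L.  Leans on: `FeshbachIsolation` (why (iii)–(iv) are fibre-local), Mathlib
`MeasureTheory.Measure.pi`, `integral_prod`, `measurePreserving` of coordinate selections, tree `wilsonMeasure`,
`partitionFunction_fundamental_ne_zero_and_ne_top`, `norm_det_mul_norm_inv_apply_le`. -/
theorem stub_fibreReduction :
    ∀ (Nf : ℕ) (γ₀ : ℝ), 0 < γ₀ → (∀ r : ℕ, ∃ C : ℝ, 0 < C ∧ TameFibre Nf γ₀ r C) →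
      ∀ (reg : QCDRegularisation Nf) (m : Fin Nf → ℝ) (β₀ p : ℝ), 0 < p →
        DistortionMomentOn reg m (1 + p) (fun k => |reg.β k| ≤ β₀) →
          ∃ γ : ℝ, 0 < γ ∧ LocalTailOn reg m γ (fun k => |reg.β k| ≤ β₀) := by
  sorry

/-- **TAME FIBRE, per minor size** (the card's delta (a) made honest by the distortion factor; classical finite-dimensional
analysis, not in Mathlib): for every `N_f` and `r` there are `γ_r, C_r > 0` with `TameFibre N_f γ_r r C_r`.  Sketch: by
column-multilinearity of `det` and Jacobi, `W ↦ det D(refit_U W)` and `W ↦ (complementary minor)` range — for ALL `L`, masses,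
outsides and placements with `≤ 2r` block sites — in ONE finite-dimensional space `V_r` of polynomials of bidegree
`≤ (12 N_f, 12 N_f)` in the entries of each of `≤ 16 r` link matrices (`PauliBandLimit` is its one-link shadow; Feshbach:
the family is even parametrised polynomially by the finite-dimensional `Γ_U`).  Two compactness facts on the unit sup-sphere
of `V_r|SU(3)^{fibre}`: UNIFORM ŁOJASIEWICZ `Haar{|P| < t·sup|P|} ≤ C t^{γ}` (zero sets of a compact analytic family have
bounded Łojasiewicz exponent: Hironaka/Łojasiewicz with parameters, van den Dries–Miller; for polynomials Remez/Brudnyi–Ganzburg/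
Carbery–Wright give `γ ≍ 1/deg`) and `∫|P| dHaar ≥ c·sup|P|` (continuity + compactness + `P ≢ 0 ⇒ ∫|P| > 0`).  Then
`∫ 𝒬 1{K𝒫<𝒬} ≤ (A s)·Haar{𝒫 < A s/K} ≤ A s·C (A/K)^γ` (as `sup 𝒫 ≥ s`) `≤ (C/c) K^{-γ} A^{1+γ} ∫ 𝒫`.  Why it might fail:
it should not (exponents `γ_r → 0` with `r` are allowed HERE); Lean size is the issue — no semialgebraic/o-minimal geometry in
Mathlib, so the uniform Łojasiewicz step must be built from `CarberyWright.remez_weak` (PROVED in tree) along circles/words as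
in the neighbouring crux's lines (`TiltedFlatness/Lines/circle-transport`: `FibreSmallBalls`, `TorusSmallBalls`).  Size L.
Leans on: tree `Literature.Analysis.Approximation.CarberyWright` (p59573), route supports `PauliBandLimit`,
`SingleLinkFlatness`, `SingleLinkLogFlatness`, `TiltedFlatness.CircleTransport.HaarRelativeSmallBalls` (nearest statement:
one function, two stars, mass window), refs Brudnyi1999, doi:10.1070/im1973v007n02abeh001941, arXiv:math/0108212,
doi:10.1215/S0012-7094-96-08416-1, doi:10.1007/BF01810850. -/
theorem stub_tameFibre : ∀ (Nf r : ℕ), ∃ γ C : ℝ, 0 < γ ∧ 0 < C ∧ TameFibre Nf γ r C := by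
  sorry

/-- **EXPONENT FLOOR — the r-level input in Feshbach dress** (triage §A / (Q): "∃δ' ∀A,B forces the a-priori exponent to be
uniform in the minor size"; every readable line needs an r-level supplier, this is ours): the exponents of `stub_tameFibre` can
be taken `≥ γ₀(N_f) > 0` for ALL `r`.  Why plausibly true: the relative small-ball exponent of the pair (`det S_T`, cominor) is
governed not by the degree of `V_r` but by the kernel strata of the Feshbach matrix — near a corank-`j` point the cominor of an
`r`-minor vanishes to order `≥ j − r` where `det S_T` vanishes to order `j`, and the `𝒬`-weighted event `{K𝒫 < 𝒬}` costs
`Haar{Π_{i≤j} σ_i(S_T) < 1/K}`; if the fibre Haar law of the small singular values of `S_T(·;Γ)` is Wegner–Minami regular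
(`≲ C_j Π_i τ_i` for windows `τ_i`, the sea paying each small singular value ONCE through `𝒫`), the exponent is `1` up to
logarithms for every `j, r` ("Pauli is a Wegner — here Minami — estimate on the fibre").  Why it might fail: degenerate
(non-Morse–Bott) kernel strata of the Wilson–Dirac Feshbach family — `det S_T` vanishing to high order along submanifolds where a
cominor does not — would force `γ_r → 0`; no Minami-type estimate is known for any non-rank-one (let alone unitary-link)
disorder (Minami1996, CombesGerminetKlein2009 are rank-one i.i.d.).  This is the structurally OPEN stub shared in substance with
every line of the crux (SRE's `SeaRepulsionMinami` with r-uniform `γ`, CSI's one-`ε`-for-all-`r`).  Size: open.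
Leans on: `stub_tameFibre` (hypothesis), `FeshbachIsolation`, refs Minami1996, AizenmanWarzel2015 Ch. 17, doi:10.4171/jems/451. -/
theorem stub_exponentFloor :
    ∀ Nf : ℕ, (∀ r : ℕ, ∃ γ C : ℝ, 0 < γ ∧ 0 < C ∧ TameFibre Nf γ r C) →
      ∃ γ₀ : ℝ, 0 < γ₀ ∧ ∀ r : ℕ, ∃ C : ℝ, 0 < C ∧ TameFibre Nf γ₀ r C := by
  sorry

/-- **DISTORTION MOMENTS — no common zeros IN MEAN** (the card's NCZ, in the averaged form triage r1-1 / r1-2 say is the only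
live one; guarded by UPPER per §B): under UPPER, for every coupling ceiling `β₀` some moment of order `1 + p > 1` of the fibre
distortion is bounded along the steps with `|β_k| ≤ β₀`, uniformly in the volume, the positions and `k`.  Why plausibly true: by
`FeshbachIsolation` the distortion is `𝔇(Γ_U)` for a semialgebraic `𝔇` of the finite-dimensional boundary matrix, infinite
exactly on the bad locus `Σ_bad = {Γ : det S_T(·;Γ) ≡ 0 on the fibre, some cominor ≢ 0}` and `≲ dist(Γ, Σ_bad)^{-κ}` near it
(Łojasiewicz); a far near-zero mode scales `det S_T` and its cominors alike (Sherman–Morrison, triage r1-2) and a mode cored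
near `T` is moved by the fibre, so `Σ_bad` is met only by holed modes with `K u ≡ 0`-type decoupling (triage r1-1's rank-one
stratum: real codimension ≥ 1, physical `Γ_reg ≠ 0`); the stub asks that the `ν`-law of `Γ_U` put mass `≲ ε^{(1+p)κ}` within
`ε` of `Σ_bad` — an anti-concentration statement for the HOLED boundary resolvent at a fixed algebraic set.  Numerics on file
point the right way (two-star ratio `max‖adj_xy‖/max|det| ≤ 1.42` over 80 tuned `d = 2` runs, `= 1.0` on `4⁴`: kit
j002311/j002312 of card pauli-wegner-band-limited-sea).  Why it might fail: if bad outsides have codimension exactly one with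
`κ ≥ 1`, no moment of order `> 1` exists (then only `p < 1/κ` and the reduction's exponent degrades but survives iff some
`p > 0` does); if the distortion must grow with an EXTENSIVE in-window mode count (the `(1+n_w)` of K1
`FibreCofactorDomination`, refuter note on stmt-11512) the stub is false and the line dies with K1.  Cheapest falsifier: the
card's computer-algebra NCZ test (2D U(1), `T` = two sites, closure incl. `Γ → ∞`) with root-finding, and `adj_xx` on the well
`O₁` of the `TiltedFlatnessTwinWell` certificate.  Size L / open.  Leans on: `FeshbachIsolation`, UPPER (hypothesis),
refs doi:10.1007/BF01810850 (Solernó, effective Łojasiewicz), doi:10.1006/aima.1998.1733 (Feshbach map), AizenmanEtAl2001. -/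
theorem stub_distortionMoment :
    ∀ (Nf : ℕ) (reg : QCDRegularisation Nf) (m : Fin Nf → ℝ), (∀ f, 0 < m f) → Upper reg m →
      ∀ β₀ : ℝ, ∃ p : ℝ, 0 < p ∧ DistortionMomentOn reg m (1 + p) (fun k => |reg.β k| ≤ β₀) := by
  sorry

/-- **WEAK-COUPLING TAIL — DECLARED GAP of the line** (replaces the card's "tilt stability in ν-average"; see the line card
§Why the regime split): under UPPER there is a coupling threshold `β₀` beyond which the local tail holds at some exponent, along
the steps with `|β_k| ≥ β₀` (vacuous for regularisations with bounded `β_k`, which `stub_fibreReduction` covers entirely; the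
`N_f = 2, 3` asymptotically free trajectories used by `closes` sit here for large `k`; the corner `β_k ≤ −β₀` is unphysical but
admissible for `QCDRegularisation` and is formally included).  NOT supplied by fibre resampling: at coupling `β` the
star-conditional law lives on a `|β|^{-1/2}`-ball around the extremisers of the fibre action, on which `𝒫` is frozen unless the relaxed configuration is
`β^{-1/2}`-close to the divisor, and the distortion moment the averaged tilt step would need is `≈ E_ν[g^{1+γ}]`, the target
itself.  Candidate mechanisms (not this line's lever): (a) admissibility — smooth plaquettes near `T` give the local
(Dirichlet/Feshbach) Wilson–Dirac operator a spectral gap (`HJLLocality`-type named facts), so `g` is bounded off a dislocation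
cored near `T`, whose `μ_W`-probability is `≲ e^{-c β}` while the sea factor `|λ|` prices the crossing; (b) the companion
one-level inputs under UPPER restricted to `β ≥ β₀` (`impurity-free-energy-minors`' cube domination for first moments,
`sea-repulsion-exponent`'s LDOS depletion) plus `stub_exponentFloor`'s r-level regularity.  Why it might fail: the bare masses
run into `m_crit(β) → 0⁻`, where the free gap closes like `1/β` while link fluctuations are `β^{-1/2}` — near-critical smooth
fields are NOT uniformly gapped in lattice units, so (a) needs the renormalised (physical-mass) gap, a slice of the continuum
limit; and dislocation moduli may sit at mode crossings with positive density.  Size: open-problem (weak-coupling / large-field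
technology).  Leans on: UPPER (hypothesis), tree `norm_inv_wilsonDirac_apply_le` (heavy corner, where it holds outright),
`HJLLocality`, refs arXiv:hep-lat/9808010, Luscher1982Topology, GoltermanShamir2003, Balaban1988Convergent. -/
theorem stub_weakCouplingTail :
    ∀ (Nf : ℕ) (reg : QCDRegularisation Nf) (m : Fin Nf → ℝ), (∀ f, 0 < m f) → Upper reg m →
      ∃ β₀ γ : ℝ, 0 < γ ∧ LocalTailOn reg m γ (fun k => β₀ ≤ |reg.β k|) := by
  sorry

/-! ### §6 Composition (no `sorry` below this line) -/

/-- Monotonicity of the tail profile `K^{-γ}` in the exponent, for `K ≥ 1`. -/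
theorem rpow_neg_antitone {K γ γ' : ℝ} (hK : 1 ≤ K) (h : γ' ≤ γ) : K ^ (-γ) ≤ K ^ (-γ') :=
  Real.rpow_le_rpow_of_exponent_le hK (neg_le_neg h)

/-- MERGING THE TWO COUPLING REGIMES (sorry-free bookkeeping): local tails on two sets of steps covering all `k`, at exponents
`γ₁, γ₂`, give the local tail along the whole trajectory at exponent `min γ₁ γ₂` with constant `max C₁ C₂`. -/
theorem localTail_of_regimes {Nf : ℕ} (reg : QCDRegularisation Nf) (m : Fin Nf → ℝ) {γ₁ γ₂ : ℝ} {P Q : ℕ → Prop}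
    (hPQ : ∀ k, P k ∨ Q k) (h₁ : LocalTailOn reg m γ₁ P) (h₂ : LocalTailOn reg m γ₂ Q) :
    LocalTail reg m (min γ₁ γ₂) := by
  intro r
  obtain ⟨C₁, hC₁, h₁⟩ := h₁ r
  obtain ⟨C₂, hC₂, h₂⟩ := h₂ r
  refine ⟨max C₁ C₂, lt_of_lt_of_le hC₁ (le_max_left _ _), ?_⟩
  filter_upwards [h₁, h₂] with k hk₁ hk₂
  intro S hS I J K hK
  have hK0 : (0 : ℝ) ≤ K := le_trans zero_le_one hK
  rcases hPQ k with hP | hQ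
  · calc _ ≤ C₁ * K ^ (-γ₁) := hk₁ hP S hS I J K hK
      _ ≤ max C₁ C₂ * K ^ (-min γ₁ γ₂) :=
        mul_le_mul (le_max_left _ _) (rpow_neg_antitone hK (min_le_left _ _)) (Real.rpow_nonneg hK0 _)
          (le_trans hC₁.le (le_max_left _ _))
  · calc _ ≤ C₂ * K ^ (-γ₂) := hk₂ hQ S hS I J K hK
      _ ≤ max C₁ C₂ * K ^ (-min γ₁ γ₂) :=
        mul_le_mul (le_max_right _ _) (rpow_neg_antitone hK (min_le_right _ _)) (Real.rpow_nonneg hK0 _)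
          (le_trans hC₂.le (le_max_right _ _))

/-- **The logic of the line is closed**: the six stub STATEMENTS imply `∀ N_f reg m > 0, Upper → Conc`.  From tame fibres
(h₃) and the exponent floor (h₄) get `γ₀`; from the weak-coupling stub (h₆) get the threshold `β₀` and the tail beyond it; the
distortion moments on `|β_k| ≤ β₀` (h₅) feed the fibre reduction (h₂) for the tail there; merge by `le_total`; transfer (h₁). -/
theorem composition_closed
    (h₁ : ∀ (Nf : ℕ) (reg : QCDRegularisation Nf) (m : Fin Nf → ℝ), (∀ f, 0 < m f) → Upper reg m →
      ∀ γ : ℝ, 0 < γ → LocalTail reg m γ → Conc reg m)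
    (h₂ : ∀ (Nf : ℕ) (γ₀ : ℝ), 0 < γ₀ → (∀ r : ℕ, ∃ C : ℝ, 0 < C ∧ TameFibre Nf γ₀ r C) →
      ∀ (reg : QCDRegularisation Nf) (m : Fin Nf → ℝ) (β₀ p : ℝ), 0 < p →
        DistortionMomentOn reg m (1 + p) (fun k => |reg.β k| ≤ β₀) →
          ∃ γ : ℝ, 0 < γ ∧ LocalTailOn reg m γ (fun k => |reg.β k| ≤ β₀))
    (h₃ : ∀ (Nf r : ℕ), ∃ γ C : ℝ, 0 < γ ∧ 0 < C ∧ TameFibre Nf γ r C)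
    (h₄ : ∀ Nf : ℕ, (∀ r : ℕ, ∃ γ C : ℝ, 0 < γ ∧ 0 < C ∧ TameFibre Nf γ r C) →
      ∃ γ₀ : ℝ, 0 < γ₀ ∧ ∀ r : ℕ, ∃ C : ℝ, 0 < C ∧ TameFibre Nf γ₀ r C)
    (h₅ : ∀ (Nf : ℕ) (reg : QCDRegularisation Nf) (m : Fin Nf → ℝ), (∀ f, 0 < m f) → Upper reg m →
      ∀ β₀ : ℝ, ∃ p : ℝ, 0 < p ∧ DistortionMomentOn reg m (1 + p) (fun k => |reg.β k| ≤ β₀))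
    (h₆ : ∀ (Nf : ℕ) (reg : QCDRegularisation Nf) (m : Fin Nf → ℝ), (∀ f, 0 < m f) → Upper reg m →
      ∃ β₀ γ : ℝ, 0 < γ ∧ LocalTailOn reg m γ (fun k => β₀ ≤ |reg.β k|)) :
    ∀ (Nf : ℕ) (reg : QCDRegularisation Nf) (m : Fin Nf → ℝ), (∀ f, 0 < m f) → Upper reg m → Conc reg m := by
  intro Nf reg m hm hU
  obtain ⟨γ₀, hγ₀, hT⟩ := h₄ Nf (h₃ Nf)
  obtain ⟨β₀, γ₂, hγ₂, hweak⟩ := h₆ Nf reg m hm hU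
  obtain ⟨p, hp, hD⟩ := h₅ Nf reg m hm hU β₀
  obtain ⟨γ₁, hγ₁, hfib⟩ := h₂ Nf γ₀ hγ₀ hT reg m β₀ p hp hD
  have htail : LocalTail reg m (min γ₁ γ₂) :=
    localTail_of_regimes reg m (fun k => le_total |reg.β k| β₀) hfib hweak
  exact h₁ Nf reg m hm hU (min γ₁ γ₂) (lt_min hγ₁ hγ₂) htail

/-- **The skeleton IS the crux proof modulo the six declared stubs**: `PhaseQuenchedFlavourDecay_of` concludes
`PauliWegnerSea.PhaseQuenchedFlavourDecay` BY NAME and uses exactly `stub_crossingSplit`, `stub_fibreReduction`,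
`stub_tameFibre`, `stub_exponentFloor`, `stub_distortionMoment`, `stub_weakCouplingTail`. -/
theorem PhaseQuenchedFlavourDecay_of :
    Summit.QuantumFields.QCD.Theses.PauliWegnerSea.PhaseQuenchedFlavourDecay :=
  crux_iff.mpr
    (composition_closed stub_crossingSplit stub_fibreReduction stub_tameFibre stub_exponentFloor
      stub_distortionMoment stub_weakCouplingTail)

/-- The SHARED copy: the item stmt-QuantumFields-9151 is the same statement in route `WilsonMobilityGap` (byte-identical body,
`Iff.rfl`), so the skeleton concludes that decl BY NAME too. -/
theorem crux_iff_wilsonMobilityGap :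
    Summit.QuantumFields.QCD.Theses.WilsonMobilityGap.PhaseQuenchedFlavourDecay ↔
      Summit.QuantumFields.QCD.Theses.PauliWegnerSea.PhaseQuenchedFlavourDecay :=
  Iff.rfl

/-- `WilsonMobilityGap.PhaseQuenchedFlavourDecay` BY NAME, from the same six stubs. -/
theorem PhaseQuenchedFlavourDecay_proof :
    Summit.QuantumFields.QCD.Theses.WilsonMobilityGap.PhaseQuenchedFlavourDecay :=
  crux_iff_wilsonMobilityGap.mpr PhaseQuenchedFlavourDecay_of

end

end Summit.QuantumFields.QCD.Cruxes.PhaseQuenchedFlavourDecay.FeshbachFibreTameness
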